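import Literature.Probability.RandomPlanarGeometry.SAWTriangularBrickWalks
import HarnessLib

/-!
# Madras' sliding rule on the triangular lattice: at first contact, nothing of `P` lies right of a nearby site of `Q′`

Topic `Literature/Probability/RandomPlanarGeometry` (lane «pcv-sawmu», a-p4 g9; first half of stub S2𝕋 of the line «TRI-MADRAS»
`q_N(𝕋) ≤ A·N^{−1/2}·μ(𝕋)^N`; brick frame of `SAWTriangularBrickWalks.lean`: sites `(X,Y) ∈ ℤ²` with `X ≡ Y (mod 2)`, steps `(±2,0)`, `(±1,±1)`).

Source: Madras' join as recalled by A. Hammond, arXiv:1504.05286v5, §4.1 p. 17: "First translate `σ` to the right by far enough that the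
`x`-coordinates of the vertices of this translate are all strictly greater than all of those of `τ`.  Now shift `σ` to the left step by step
until the first time at which there is a pair of vertices, one in `τ` and the other in the `σ`-translate, that share an `x`-coordinate and whose
`y`-coordinates differ by at most two … no vertex of `τ` belongs to the right corridor … (Indeed, it is this fact that implies that `τ̃` is a
polygon.)  Equally, no vertex of `σ′` belongs to the left corridor"; the slide itself is printed ibid. §3.4 p. 12: "Translate `φ′` vertically so
that some vertices in `φ` and `φ′` share their `y`-coordinate, and then push `φ′` to the right … Then push `φ′` back to the left stopping just
before the two polygons overlap" (this is the printed home of the lane phrase «slide until first contact»; N. Madras, J. Stat. Phys. 78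
(1995) §2 is the primary, not held by the lane).  Triangular edition: `Q` slides leftwards in steps of `(2,0)`; CONTACT at
shift `s` means some `t ∈ P` and `w ∈ Q + (s,0)` are close, `t − w ∈ 𝒩 := {(0,0), (0,±2), (±1,±1)}`; FIRST contact = the largest such `s`.
The single fact behind both of Hammond's corridor remarks (and behind the row order used by the decoding lemma
`SAWTriangularPolygonJoinDecode.isRowSepCut_unique`) is: **at first contact no site of `P` lies strictly to the right of a site of
`Q + (s,0)` within two rows of it** (`le_of_isFirstContact`) — else the two sites would have been close at a larger shift.

## What is proved (namespace `…SAW.TriPolygon`; all `theorem`s, axioms standard)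

* `IsCloseShift t w s` (`t − (w + (s,0)) ∈ 𝒩`), `IsContactShift P Q s`, `IsFirstContact P Q s`, `contactShifts P Q` (+ `mem_contactShifts_iff`);
* `exists_isFirstContact` (a first contact exists as soon as some rows of `P` and `Q` are within two of each other);
* **`le_of_isFirstContact`**: at first contact, `t ∈ P`, `w ∈ Q`, `|Y(t) − Y(w)| ≤ 2 ⇒ X(t) ≤ X(w) + s`; corollaries `row_order_of_isFirstContact`
  (same row ⇒ weakly left) and `contact_type_of_isFirstContact` (a first-contact pair has `X(t) − X(w) − s ∈ {0, −1}`).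
-/

noncomputable section

open Literature.Probability.LatticeModels

namespace Literature.Probability.RandomPlanarGeometry.SAW

namespace TriPolygon

variable {P Q : Finset (Site 2)} {s : ℤ}

/-- `t` is close to `w + (s,0)`: `t − w − (s,0) ∈ 𝒩 = {(0,0), (0,±2), (±1,±1)}` (same column within two rows, or a diagonal neighbour).
[cite: Hammond2015SAPJoining, §4.1 (arXiv v5 p. 17: "share an x-coordinate and whose y-coordinates differ by at most two")] -/
def IsCloseShift (t w : Site 2) (s : ℤ) : Prop :=
  (t 0 = w 0 + s ∧ (t 1 = w 1 ∨ t 1 = w 1 + 2 ∨ t 1 + 2 = w 1)) ∨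
    ((t 0 = w 0 + s + 1 ∨ t 0 + 1 = w 0 + s) ∧ (t 1 = w 1 + 1 ∨ t 1 + 1 = w 1))

/-- `s` is a contact shift of `(P, Q)`: some site of `P` is close to some site of `Q + (s,0)`.
[cite: Hammond2015SAPJoining, §4.1 (arXiv v5 p. 17)] -/
def IsContactShift (P Q : Finset (Site 2)) (s : ℤ) : Prop := ∃ t ∈ P, ∃ w ∈ Q, IsCloseShift t w s

/-- `s` is the FIRST contact shift: a contact shift such that no larger shift of the same parity is one ("shift `σ` to the left step by
step until the first time …"). [cite: Hammond2015SAPJoining, §4.1 (arXiv v5 p. 17)] -/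
def IsFirstContact (P Q : Finset (Site 2)) (s : ℤ) : Prop :=
  IsContactShift P Q s ∧ ∀ k : ℤ, 1 ≤ k → ¬IsContactShift P Q (s + 2 * k)

/-- On the even sublattice every contact shift is even. [cite: Grimmett2018, §5.5 (the sublattice X ≡ Y (mod 2))] -/
theorem even_of_isContactShift (hP : ∀ t ∈ P, (t 0 + t 1) % 2 = 0) (hQ : ∀ w ∈ Q, (w 0 + w 1) % 2 = 0)
    (h : IsContactShift P Q s) : s % 2 = 0 := by
  obtain ⟨t, ht, w, hw, hc⟩ := h
  have h1 := hP t ht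
  have h2 := hQ w hw
  unfold IsCloseShift at hc
  omega

/-- **Madras' corridor fact, triangular edition.**  At first contact, a site of `P` within two rows of a site of `Q + (s,0)` is weakly to its
left: `X(t) ≤ X(w) + s` — otherwise the two would have been close at the larger shift `s + 2k`, `2k` or `2k ∓ 1 = X(t) − X(w) − s`.
[cite: Hammond2015SAPJoining, §4.1 (arXiv v5 p. 17: "no vertex of τ belongs to the right corridor … Equally, no vertex of σ′ belongs to the left
corridor")] -/
theorem le_of_isFirstContact (hP : ∀ t ∈ P, (t 0 + t 1) % 2 = 0) (hQ : ∀ w ∈ Q, (w 0 + w 1) % 2 = 0)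
    (h : IsFirstContact P Q s) {t w : Site 2} (ht : t ∈ P) (hw : w ∈ Q) (hy1 : w 1 ≤ t 1 + 2) (hy2 : t 1 ≤ w 1 + 2) :
    t 0 ≤ w 0 + s := by
  by_contra hcon
  push Not at hcon
  have hs := even_of_isContactShift hP hQ h.1
  have h1 := hP t ht
  have h2 := hQ w hw
  -- `d := t 0 - w 0 - s ≥ 1`, `d ≡ t 1 - w 1 (mod 2)`
  rcases Int.emod_two_eq_zero_or_one (t 1 - w 1) with he | ho
  · -- same column after a further shift by `d = 2k`
    refine h.2 ((t 0 - w 0 - s) / 2) (by omega) ⟨t, ht, w, hw, ?_⟩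
    unfold IsCloseShift
    omega
  · by_cases hd : t 0 - w 0 - s = 1
    · refine h.2 1 (by omega) ⟨t, ht, w, hw, ?_⟩
      unfold IsCloseShift
      omega
    · refine h.2 ((t 0 - w 0 - s - 1) / 2) (by omega) ⟨t, ht, w, hw, ?_⟩
      unfold IsCloseShift
      omega

/-- At first contact, `P` is weakly left of `Q + (s,0)` in every row. [cite: Hammond2015SAPJoining, §4.1 (arXiv v5 p. 17)] -/
theorem row_order_of_isFirstContact (hP : ∀ t ∈ P, (t 0 + t 1) % 2 = 0) (hQ : ∀ w ∈ Q, (w 0 + w 1) % 2 = 0)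
    (h : IsFirstContact P Q s) {t w : Site 2} (ht : t ∈ P) (hw : w ∈ Q) (hy : t 1 = w 1) : t 0 ≤ w 0 + s :=
  le_of_isFirstContact hP hQ h ht hw (by omega) (by omega)

/-- At first contact, a contact pair is of type `(0,0)`, `(0,±2)` or `(−1,±1)`: never `(+1,±1)`.
[cite: Hammond2015SAPJoining, §4.1 (arXiv v5 p. 17: the vertex Y)] -/
theorem contact_type_of_isFirstContact (hP : ∀ t ∈ P, (t 0 + t 1) % 2 = 0) (hQ : ∀ w ∈ Q, (w 0 + w 1) % 2 = 0)
    (h : IsFirstContact P Q s) {t w : Site 2} (ht : t ∈ P) (hw : w ∈ Q) (hc : IsCloseShift t w s) :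
    t 0 = w 0 + s ∨ t 0 + 1 = w 0 + s := by
  have hle := le_of_isFirstContact hP hQ h ht hw (by unfold IsCloseShift at hc; omega) (by unfold IsCloseShift at hc; omega)
  unfold IsCloseShift at hc
  omega

/-! ### Existence of the first contact -/

open Classical in
/-- The finitely many candidate contact shifts (`X(t) − X(w) + {−1, 0, 1}` over `t ∈ P`, `w ∈ Q`), filtered to the contact shifts.
[cite: Hammond2015SAPJoining, §4.1 (arXiv v5 p. 17: "such a moment necessarily occurs")] -/
def contactShifts (P Q : Finset (Site 2)) : Finset ℤ :=
  (((P ×ˢ Q).image fun tw => tw.1 0 - tw.2 0) ∪ ((P ×ˢ Q).image fun tw => tw.1 0 - tw.2 0 - 1) ∪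
      ((P ×ˢ Q).image fun tw => tw.1 0 - tw.2 0 + 1)).filter fun s => IsContactShift P Q s

/-- `contactShifts P Q` is exactly the set of contact shifts. [cite: Hammond2015SAPJoining, §4.1 (arXiv v5 p. 17)] -/
theorem mem_contactShifts_iff : s ∈ contactShifts P Q ↔ IsContactShift P Q s := by
  classical
  unfold contactShifts
  rw [Finset.mem_filter]
  refine ⟨fun h => h.2, fun h => ⟨?_, h⟩⟩
  obtain ⟨t, ht, w, hw, hc⟩ := h
  have htw : (t, w) ∈ P ×ˢ Q := Finset.mem_product.2 ⟨ht, hw⟩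
  simp only [Finset.mem_union, Finset.mem_image]
  unfold IsCloseShift at hc
  rcases hc with ⟨hx, -⟩ | ⟨hx | hx, -⟩
  · exact Or.inl (Or.inl ⟨(t, w), htw, by simp only; omega⟩)
  · exact Or.inl (Or.inr ⟨(t, w), htw, by simp only; omega⟩)
  · exact Or.inr ⟨(t, w), htw, by simp only; omega⟩

/-- **A first contact exists** as soon as some site of `P` is within two rows of some site of `Q` ("such a moment necessarily occurs, by the
assumption" that the row ranges, widened by one, intersect — Hammond's displayed interval condition).
[cite: Hammond2015SAPJoining, §4.1 (arXiv v5 p. 17: the interval condition and "such a moment necessarily occurs")] -/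
theorem exists_isFirstContact (h : ∃ t ∈ P, ∃ w ∈ Q, w 1 ≤ t 1 + 2 ∧ t 1 ≤ w 1 + 2) : ∃ s, IsFirstContact P Q s := by
  classical
  obtain ⟨t, ht, w, hw, hy1, hy2⟩ := h
  -- a contact shift exists
  have hne : (contactShifts P Q).Nonempty := by
    rcases Int.emod_two_eq_zero_or_one (t 1 - w 1) with he | ho
    · refine ⟨t 0 - w 0, mem_contactShifts_iff.2 ⟨t, ht, w, hw, ?_⟩⟩
      unfold IsCloseShift; omega
    · refine ⟨t 0 - w 0 - 1, mem_contactShifts_iff.2 ⟨t, ht, w, hw, ?_⟩⟩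
      unfold IsCloseShift; omega
  refine ⟨(contactShifts P Q).max' hne, mem_contactShifts_iff.1 (Finset.max'_mem _ hne), fun k hk hcon => ?_⟩
  have hle := Finset.le_max' (contactShifts P Q) _ (mem_contactShifts_iff.2 hcon)
  omega

end TriPolygon

end Literature.Probability.RandomPlanarGeometry.SAW

end
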